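import Summits.Ventures.PercRepro.RankLevelSetTopCountCoindep

/-!
# PercRepro — three triangles: the coindependent independent `6`-sets at corank `≤ 8` (p8 g12, S3)

The form (i) of THE CONFINEMENT LEMMA at corank `8` (`proofs/P8-G12-LEVER22.md` §3, §7): two distinct triangles of a core
share at most one point (no 4-point line: `r(C₁ ∪ C₂) = 2` would give a rank-`2` set of `≥ 4` points), three distinct triangles
have a union of nullity `≥ 3`, and every coindependent set `B` with `|B| ≥ d − 2` meets their union — so at `d ≤ 8` the
coindependent independent `6`-sets number at most `C(n, 6) − C(n − 9, 6)`. Axioms: standard.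
-/

open scoped Matroid

namespace PercRepro

namespace Matroid

open Set

variable {α : Type} {M : _root_.Matroid α}

/-- **Two distinct triangles of a core share at most one point** (`hC1`: no rank-`2` set has `≥ 4` points). -/
theorem ncard_inter_le_one_of_triangles [M.Finite] (hC1 : ∀ L ⊆ M.E, M.eRk L = 2 → L.ncard ≤ 3)
    {C₁ C₂ : Set α} (h1 : M.IsCircuit C₁) (h2 : M.IsCircuit C₂) (n1 : C₁.ncard = 3) (n2 : C₂.ncard = 3)
    (hne : C₁ ≠ C₂) : (C₁ ∩ C₂).ncard ≤ 1 := by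
  by_contra hcon
  have hcon' : 2 ≤ (C₁ ∩ C₂).ncard := by omega
  have hEfin : M.E.Finite := M.ground_finite
  have hf1 : C₁.Finite := hEfin.subset h1.subset_ground
  have hf2 : C₂.Finite := hEfin.subset h2.subset_ground
  have hss : C₁ ∩ C₂ ⊂ C₁ := by
    refine ⟨Set.inter_subset_left, fun h => hne ?_⟩
    exact h1.eq_of_subset_isCircuit h2 (fun x hx => (h hx).2)
  have hI : M.Indep (C₁ ∩ C₂) := h1.ssubset_indep hss
  have hIr : M.eRk (C₁ ∩ C₂) = ((C₁ ∩ C₂).ncard : ℕ∞) := by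
    rw [hI.eRk_eq_encard, (hf1.subset Set.inter_subset_left).cast_ncard_eq]
  obtain ⟨r1, hr1⟩ := ThmN.exists_eRk_eq_nat M C₁
  obtain ⟨r2, hr2⟩ := ThmN.exists_eRk_eq_nat M C₂
  obtain ⟨ru, hru⟩ := ThmN.exists_eRk_eq_nat M (C₁ ∪ C₂)
  have hC1r : r1 + 1 = C₁.ncard := by
    have h := h1.eRk_add_one_eq
    rw [hr1, ← hf1.cast_ncard_eq] at h
    exact_mod_cast h
  have hC2r : r2 + 1 = C₂.ncard := by
    have h := h2.eRk_add_one_eq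
    rw [hr2, ← hf2.cast_ncard_eq] at h
    exact_mod_cast h
  have hsub := M.eRk_inter_add_eRk_union_le C₁ C₂
  rw [hIr, hru, hr1, hr2] at hsub
  have hsubN : (C₁ ∩ C₂).ncard + ru ≤ r1 + r2 := by exact_mod_cast hsub
  have hmono : M.eRk C₁ ≤ M.eRk (C₁ ∪ C₂) := M.eRk_mono Set.subset_union_left
  rw [hr1, hru] at hmono
  have hmonoN : r1 ≤ ru := by exact_mod_cast hmono
  have hu : (C₁ ∪ C₂).ncard + (C₁ ∩ C₂).ncard = C₁.ncard + C₂.ncard :=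
    Set.ncard_union_add_ncard_inter C₁ C₂ hf1 hf2
  have hru2 : ru = 2 := by omega
  have hcap := hC1 (C₁ ∪ C₂) (Set.union_subset h1.subset_ground h2.subset_ground) (by rw [hru, hru2]; rfl)
  omega

/-- **The coindependent independent `6`-sets at corank `d ≤ 8` with three distinct triangles**: at most
`C(n, 6) − C(n − 9, 6)` (as `#{…} + C(n − 9, 6) ≤ C(n, 6)`). -/
theorem ncard_indep_six_coindep_add_choose_le_of_three_triangles [M.Finite]
    (hC1 : ∀ L ⊆ M.E, M.eRk L = 2 → L.ncard ≤ 3) {p d : ℕ} (hn : M.E.ncard = p + d)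
    {C₁ C₂ C₃ : Set α} (h1 : M.IsCircuit C₁) (h2 : M.IsCircuit C₂) (h3 : M.IsCircuit C₃)
    (n1 : C₁.ncard = 3) (n2 : C₂.ncard = 3) (n3 : C₃.ncard = 3)
    (h12 : C₁ ≠ C₂) (h13 : C₁ ≠ C₃) (h23 : C₂ ≠ C₃) (hd : d ≤ 8) :
    {B : Set α | B ⊆ M.E ∧ B.ncard = 6 ∧ M.eRk (M.E \ B) = (p : ℕ∞)}.ncard + (p + d - 9).choose 6 ≤
      (p + d).choose 6 := by
  classical
  have i12 := ncard_inter_le_one_of_triangles hC1 h1 h2 n1 n2 h12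
  have i13 := ncard_inter_le_one_of_triangles hC1 h1 h3 n1 n3 h13
  have i23 := ncard_inter_le_one_of_triangles hC1 h2 h3 n2 n3 h23
  have hEcard : M.ground_finite.toFinset.card = p + d := by
    rw [← Set.ncard_eq_toFinset_card _ M.ground_finite]; exact hn
  have hS : C₁ ∪ C₂ ∪ C₃ ⊆ (M.ground_finite.toFinset : Set α) := by
    rw [Set.Finite.coe_toFinset]
    exact Set.union_subset (Set.union_subset h1.subset_ground h2.subset_ground) h3.subset_ground
  have hs9 : (C₁ ∪ C₂ ∪ C₃).ncard ≤ 9 := by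
    have a := Set.ncard_union_le (C₁ ∪ C₂) C₃
    have b := Set.ncard_union_le C₁ C₂
    omega
  have hsub : {B : Set α | B ⊆ M.E ∧ B.ncard = 6 ∧ M.eRk (M.E \ B) = (p : ℕ∞)} ⊆
      {B : Set α | B ⊆ (M.ground_finite.toFinset : Set α) ∧ B.ncard = 6 ∧ (B ∩ (C₁ ∪ C₂ ∪ C₃)).Nonempty} := by
    rintro B ⟨hBE, hB6, hspan⟩
    refine ⟨?_, hB6, ?_⟩
    · rw [Set.Finite.coe_toFinset]
      exact hBE
    · have key := ThmN.inter_union_nonempty_of_spanning_of_three_triangles M (A := M.E \ B) sdiff_subset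
        h1 h2 h3 n1 n2 n3 i12 i13 i23 hn hspan (by rw [sdiff_sdiff_cancel_left hBE]; omega)
      rwa [sdiff_sdiff_cancel_left hBE] at key
  have hfin : {B : Set α | B ⊆ (M.ground_finite.toFinset : Set α) ∧ B.ncard = 6 ∧
      (B ∩ (C₁ ∪ C₂ ∪ C₃)).Nonempty}.Finite :=
    (M.ground_finite.toFinset.finite_toSet.finite_subsets).subset (fun B hB => hB.1)
  have hle := Set.ncard_le_ncard hsub hfin
  have hcount := ncard_subsets_meeting_add_choose_le_of_ncard_le M.ground_finite.toFinset (C₁ ∪ C₂ ∪ C₃) hS 6 9 hs9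
  rw [hEcard] at hcount
  omega

end Matroid

end PercRepro
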